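import Literature.Topology.FourManifolds.SmallSetComplement
import Summits.SmoothPoincare4.SmoothPoincare4.Theses.DottedCircleRasmussen
import Summits.SmoothPoincare4.SmoothPoincare4.Theorems.DottedCircleRasmussenDcrGapStubFriendsPi1AsmExterior

/-!
# Assembly of stub `stub_friendsPi1` (line `mk_friends`, skeleton v2–v3, crux `DcrGap`), part 2: the carrier is path connected
(item stmt-SmoothPoincare4-16128, route route-SmoothPoincare4-DottedCircleRasmussen)

`helper_friendsPi1_asm_pathConnected` (registered helper of the line): the friends-swap carrier `X`, a
`4`-manifold written as `X = j(E) ⊔ i(D_k) ∪ f₀(𝔻²) ⊔ {q}` with `j : E ↪ X` continuous on the path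
connected model disc exterior `E`, `q` the limit of `j(a)` as `‖a‖ → ∞`, `i` a continuous injective germ
chart on an open `U ⊇ D_k` and `f₀` a smooth disc whose interior misses `i(D_k)`, is path connected.

Proof.  `A = closure j(E)` is connected and contains `q` (`E` is unbounded); `B = f₀(𝔻²)` is
connected and meets `A` at `f₀(0)`: near `f₀(0) ∉ i(D_k)` the set `B ∪ {q}` is a countable union of
`C¹` images of the plane, of codimension `2` in the `4`-manifold `X`, so it has empty interior there
(the tree's `exists_nhds_joinedIn_compl`) and `j(E)` accumulates at `f₀(0)`.  Every point `i(d)`,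
`d ∈ D_k`, is joined to `A ∪ B` by the `i`-image of an exit path of `d` inside `U`
(`FriendsPi1.exists_exit`: its far end `i(d')`, `d' ∈ U ∖ D_k`, is not in `i(D_k)` by injectivity, so
it lies in `j(E) ∪ {q} ∪ B ⊆ A ∪ B`).  Hence `X` is connected, and a connected manifold is path connected
(manifolds are locally path connected).

No definitions, no named facts, no `sorry`.
-/

-- the prescribed namespace `Summit.<P>.<Sub>.…` duplicates `SmoothPoincare4` (P = Sub)
set_option linter.dupNamespace false
set_option linter.style.longLine false

noncomputable section

open scoped Manifold ContDiff Topology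
open Function Set Metric Module
open Literature.Topology.FourManifolds Literature.Topology.FourManifolds.MMSW

namespace Summit.SmoothPoincare4.SmoothPoincare4.Theorems.DcrGap.MkFriends

/-- **The friends-swap carrier is path connected** (registered helper
`helper_friendsPi1_asm_pathConnected` of line `mk_friends`; see the module docstring for the proof).
[cite: HurewiczWallman1941, Ch. IV §5, Thm. IV 4 and Cor. 1] -/
theorem helper_friendsPi1_asm_pathConnected : ∀ (k : ℕ) (X : Type) [TopologicalSpace X] [T2Space X] [ChartedSpace (EuclideanSpace ℝ (Fin 4)) X] [IsManifold (𝓡 4) ((⊤ : ℕ∞) : WithTop ℕ∞) X] (U : Set (EuclideanSpace ℝ (Fin 4))) (i : EuclideanSpace ℝ (Fin 4) → X) (f₀ : EuclideanSpace ℝ (Fin 2) → X) (E : TopologicalSpace.Opens (EuclideanSpace ℝ (Fin 4))) (j : E → X) (q : X), IsOpen U → Literature.Topology.FourManifolds.MMSW.modelHandlebody k ⊆ U → ContinuousOn i U → Set.InjOn i U → ContMDiff (𝓡 2) (𝓡 4) ((⊤ : ℕ∞) : WithTop ℕ∞) f₀ → (∀ x : EuclideanSpace ℝ (Fin 2), ‖x‖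 < 1 → f₀ x ∉ i '' Literature.Topology.FourManifolds.MMSW.modelHandlebody k) → IsPathConnected (E : Set (EuclideanSpace ℝ (Fin 4))) → (∀ R : ℝ, ∃ a : E, R < ‖(a : EuclideanSpace ℝ (Fin 4))‖) → Continuous j → Set.range j = (i '' Literature.Topology.FourManifolds.MMSW.modelHandlebody k ∪ f₀ '' Metric.closedBall (0 : EuclideanSpace ℝ (Fin 2)) 1 ∪ {q})ᶜ → (∀ s ∈ nhds q, ∃ R : ℝ, ∀ a : E, R < ‖(a : EuclideanSpace ℝ (Fin 4))‖ → j a ∈ s) → PathConnectedSpace X := by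
  intro k X _ _ _ _ U i f₀ E j q hU hDU hi hinj hf₀ hf₀out hEpc hEunb hj hrange hq
  -- the pieces
  set B : Set X := f₀ '' closedBall (0 : EuclideanSpace ℝ (Fin 2)) 1 with hB
  set A : Set X := closure (range j) with hA
  have hDc : IsCompact (modelHandlebody k) := isCompact_modelHandlebody k
  have hiD : IsClosed (i '' modelHandlebody k) := (hDc.image_of_continuousOn (hi.mono hDU)).isClosed
  have hf₀c : Continuous f₀ := hf₀.continuous
  have hBconn : IsPreconnected B :=
    ((convex_closedBall (0 : EuclideanSpace ℝ (Fin 2)) 1).isPreconnected).image f₀ hf₀c.continuousOn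
  -- every point is in `range j`, in `i(D_k) ∪ B`, or is `q`
  have hcases : ∀ y : X, y ∈ range j ∨ (y ∈ i '' modelHandlebody k ∪ B ∨ y = q) := fun y => by
    by_cases h : y ∈ range j
    · exact Or.inl h
    · right
      rw [hrange, mem_compl_iff, not_not] at h
      rcases h with h | h
      · exact Or.inl h
      · exact Or.inr h
  -- `A` is preconnected (`E` is path connected)
  haveI : PreconnectedSpace E :=
    isPreconnected_iff_preconnectedSpace.1 hEpc.isConnected.isPreconnected
  have hAconn : IsPreconnected A := (isPreconnected_range hj).closure
  -- `q ∈ A`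
  have hqA : q ∈ A := by
    rw [hA, mem_closure_iff_nhds]
    intro s hs
    obtain ⟨R, hR⟩ := hq s hs
    obtain ⟨a, ha⟩ := hEunb R
    exact ⟨j a, hR a ha, mem_range_self a⟩
  -- `f₀ 0 ∈ A ∩ B`
  have h0B : f₀ 0 ∈ B := ⟨0, mem_closedBall_self zero_le_one, rfl⟩
  have h0A : f₀ 0 ∈ A := by
    rw [hA, mem_closure_iff_nhds]
    intro s hs
    have h0 : f₀ 0 ∉ i '' modelHandlebody k := hf₀out 0 (by simp)
    have hV : s ∩ (i '' modelHandlebody k)ᶜ ∈ 𝓝 (f₀ 0) := Filter.inter_mem hs (hiD.isOpen_compl.mem_nhds h0)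
    -- the small set `B ∪ {q}`
    have hdim : finrank ℝ (EuclideanSpace ℝ (Fin 2)) + 2 ≤ finrank ℝ (EuclideanSpace ℝ (Fin 4)) := by simp
    let g : Bool → EuclideanSpace ℝ (Fin 2) → X := fun b => if b then f₀ else fun _ => q
    have hg : ∀ b, ContMDiffOn 𝓘(ℝ, EuclideanSpace ℝ (Fin 2)) (𝓡 4) 1 (g b) univ := fun b => by
      cases b
      · exact contMDiffOn_const
      · exact (hf₀.of_le (by exact_mod_cast le_top)).contMDiffOn
    have hS : B ∪ {q} ⊆ ⋃ b, g b '' univ := by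
      rintro y (⟨x, -, rfl⟩ | hy)
      · exact mem_iUnion.2 ⟨true, x, mem_univ _, rfl⟩
      · rw [mem_singleton_iff] at hy
        exact mem_iUnion.2 ⟨false, 0, mem_univ _, hy.symm⟩
    obtain ⟨N, -, -, hNV, ⟨y, hyN, hyS⟩, -⟩ :=
      exists_nhds_joinedIn_compl (I := 𝓡 4) hdim g (fun _ => univ) (fun _ => isOpen_univ) hg hS
        (BoundarylessManifold.isInteriorPoint (x := f₀ 0)) hV
    obtain ⟨hys, hyi⟩ := hNV hyN
    refine ⟨y, hys, ?_⟩
    rw [hrange]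
    rintro ((h | h) | h)
    · exact hyi h
    · exact hyS (Or.inl h)
    · exact hyS (Or.inr h)
  -- `A ∪ B` is preconnected
  have hAB : IsPreconnected (A ∪ B) := hAconn.union (f₀ 0) h0A h0B hBconn
  -- points of `i(D_k)` are joined to `A ∪ B` by exit paths
  have hexit : ∀ d ∈ modelHandlebody k, ∃ t : Set X, IsPreconnected t ∧ i d ∈ t ∧ (t ∩ (A ∪ B)).Nonempty :=
    fun d hd => by
      obtain ⟨d', hd'U, hd'D, hjn⟩ := FriendsPi1.exists_exit k hU hDU hd
      have hjn' : JoinedIn (i '' U) (i d) (i d') := hjn.map_continuousOn hi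
      set γ : Path (i d) (i d') := hjn'.somePath with hγ
      have hid' : i d' ∈ A ∪ B := by
        rcases hcases (i d') with h | (⟨e, he, hee⟩ | h) | h
        · exact Or.inl (subset_closure h)
        · exact absurd (hinj hd'U (hDU he) hee.symm ▸ he) hd'D
        · exact Or.inr h
        · exact Or.inl (h ▸ hqA)
      refine ⟨range γ, isPreconnected_range γ.continuous, ⟨0, γ.source⟩, i d', ⟨1, γ.target⟩, hid'⟩
  -- `X` is connected
  have huniv : IsPreconnected (univ : Set X) := by
    refine isPreconnected_of_forall (f₀ 0) fun y _ => ?_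
    rcases hcases y with hy | (⟨d, hd, rfl⟩ | hy) | rfl
    · exact ⟨A ∪ B, subset_univ _, Or.inl h0A, Or.inl (subset_closure hy), hAB⟩
    · obtain ⟨t, ht, hdt, z, hzt, hzAB⟩ := hexit d hd
      exact ⟨(A ∪ B) ∪ t, subset_univ _, Or.inl (Or.inl h0A), Or.inr hdt, hAB.union z hzAB hzt ht⟩
    · exact ⟨A ∪ B, subset_univ _, Or.inl h0A, Or.inr hy, hAB⟩
    · exact ⟨A ∪ B, subset_univ _, Or.inl h0A, Or.inl hqA, hAB⟩
  haveI : PreconnectedSpace X := ⟨huniv⟩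
  haveI : ConnectedSpace X := ⟨⟨f₀ 0⟩⟩
  -- a connected manifold is path connected
  haveI : LocallyPathConnectedSpace X :=
    ChartedSpace.locallyPathConnectedSpace (EuclideanSpace ℝ (Fin 4)) X
  exact pathConnectedSpace_iff_connectedSpace.2 inferInstance

end Summit.SmoothPoincare4.SmoothPoincare4.Theorems.DcrGap.MkFriends

end
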